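import Literature.AlgebraicGeometry.Frobenioids.FiberProductsBiratUnits
import Literature.IUT.HodgeTheaters.GlobalFrobenioidsBiratUnits
import HarnessLib

/-!
# [IUTchI] Example 5.1 (vi) for (iv): the rational functions of `†ℱ^⊚ := †ℱ^⊛|_{†𝒟^⊚}` — `𝒪^×(A^birat)` for
# `A ∈ Ob(†ℱ^⊚)` IS the multiplicative group of the number field of the image of `A` in `†𝒟^⊛`, naturally and
# compatibly with divisors

S. Mochizuki, *Inter-universal Teichmüller theory I*, §5, Example 5.1, kurims manuscript (May 2020) (own render of
the kurims PDF, `cat -n` numbering) [claim: Mochizuki2012, status: disputed]: (vi) p. 130 l. 9–11: "Before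
proceeding, we observe that the discussion of (iv), (v) concerning `†ℱ^⊛`, `†𝒟^⊛` may also be carried out for
`†ℱ^⊚`, `†𝒟^⊚`. We leave the routine details to the reader."; (iv) p. 126 l. 18–21: "Thus, if `A ∈ Ob(†ℱ^⊛)`, then `𝒪^×(A^birat)` may be naturally identified with the
multiplicative group of nonzero elements of the number field [i.e., finite extension of `F_mod`] corresponding to
`A`."; (iii) pp. 125–126: "`†ℱ^⊚ := †ℱ^⊛|_{†𝒟^⊚} (→ †ℱ^⊛)` […] the restriction of `†ℱ^⊛` to `†𝒟^⊚` via the natural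
morphism `†𝒟^⊚ → †𝒟^⊛`".

STATE OF THE TREE.  abc-iut-L5-t1 types `†ℱ^⊚` as `GlobalFrobenioid.Fcirc` = the §0 categorical fibre product
`†ℱ^⊛ ×_{Base(†ℱ^⊛)} †𝒟^⊚`; abc-iut-w4-d050 (gen 0) proved it is a Frobenioid via an equivalence `e` — identity on
both components — to abc-iut-L1's [FrdI] Prop 1.6 fibre product of the structure functor `†ℱ^⊛ → F_{Φ^⊛}` with
`†𝒟^⊚ → Base(†ℱ^⊛) ⥲ †𝒟^⊛` (`exists_fcirc_equivalence_fiberProduct`, `isFrobenioid_fiberProductOverIdentify`,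
`fcirc_isFrobenioid`).  The (iv)-clause for `†ℱ^⊛` itself is `GlobalFrobenioid.nonempty_rationalFunctionMonoidStr_equivToElem`
(`GlobalFrobenioidsBiratUnits.lean`, w4-d050 gen 3).

THIS FILE (proof-only, 0 `def`s) carries out the (iv)-clause for `†ℱ^⊚`: the rational-function monoid `A ↦ 𝒪^×(A^birat)` of
`†ℱ^⊚` (abc-iut-L1's explicit `PreFrobenioid.BiratUnits`, [FrdI] Prop 4.4) IS the restriction
`A_⊚ ↦ 𝔹(A_⊚ ↦ †𝒟^⊛) = 𝕄^⊛(†𝒟^⊚)^{A_⊚ ↦ †𝒟^⊛}` of the rational-function monoid `𝔹` of `†ℱ^⊛` along `†𝒟^⊚ → †𝒟^⊛`,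
naturally in `A` and compatibly with divisors — by the fibre-product clause
`RationalFunctionMonoidStr.nonempty_fiberProduct` ([FrdI] Prop 1.6 (iii)(iv) on `𝒪^×(−^birat)`, our L1 file
`Frobenioids/FiberProductsBiratUnits.lean`) and the transport along `e` ([FrdI] Cor 4.10,
`RationalFunctionMonoidStr.nonempty_precomp_equivalence`):
* `GlobalFrobenioid.nonempty_rationalFunctionMonoidStr_fiberProductOverIdentify` — for the Prop 1.6 model of `†ℱ^⊚`;
* `GlobalFrobenioid.fcirc_exists_rationalFunctionMonoidStr` — for t1's literal `†ℱ^⊚ = Fcirc` (through `e`);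
* `…_of_baseCat` — the three [FrdI] Prop 1.6 inputs discharged for `†𝒟^⊚ = ℬ(π₁(†𝒟^⊚))⁰` (w4-d050 gen 2,
  `isFSM_map_of_baseCat`), and `…_arith_of_baseCat` / `…_arithAlong_of_baseCat` UNCONDITIONAL at the arithmetic
  models, with the units reading `fcirc_exists_units_mulEquiv_biratUnits_arith_of_baseCat`:
  `𝒪^×(A^birat) ≅ (F̄^{Stab})ˣ` for the number field of the image of `A_⊚` in `†𝒟^⊛`, compatibly with `div`;
* `fmod_exists_rationalFunctionMonoidStr` / `fmod_exists_units_mulEquiv_biratUnits_arith` — the same for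
  `†ℱ^⊛_mod := †ℱ^⊛|_{terminal objects}` (its birationalization `†ℱ^{⊛birat}_mod` is named in (iv) p. 126 l. 15–17):
  rational-function monoid = `𝔹` on the terminal objects; at the arithmetic model `𝒪^×(A^birat) ≅ F_mod^×`.

Nothing of [IUTchI] is asserted beyond this bookkeeping identity; no new Prop fact; no side is taken on
[IUTchIII] Cor. 3.12.  Mathematics: [cite: MochizukiFrdI2008, Prop. 1.6 p.27], [cite: MochizukiFrdI2008, Cor. 4.10 p.90],
[cite: MochizukiFrdI2008, Thm. 5.2(ii) p.101].
-/

noncomputable section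

namespace Literature.IUT.HodgeTheaters

open CategoryTheory Opposite Literature.AlgebraicGeometry.Frobenioids
open Literature.AlgebraicGeometry.Frobenioids.QuasiTemperoid

universe u

namespace GlobalFrobenioid

section General

variable {G : ProfiniteGrp.{u}} {Δ : GlobalDivisorData G} {Dcirc : Type (u + 1)} [Category.{u} Dcirc]
  {toBase0 : Dcirc ⥤ BaseCat G} (F : GlobalFrobenioid Δ Dcirc toBase0)

/-- **[IUTchI] Ex 5.1 (vi)/(iv) for the [FrdI] Prop 1.6 model of `†ℱ^⊚`**: for the fibre product of
`†ℱ^⊛ → ℱ^⊛(†𝒟^⊚) → F_{Φ^⊛}` with `†𝒟^⊚ → Base(†ℱ^⊛) ⥲ †𝒟^⊛` and its Prop 1.6 (ii) structure functor, the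
rational-function monoid `A ↦ 𝒪^×(A^birat)` IS `A_⊚ ↦ 𝔹(A_⊚ ↦ †𝒟^⊛)` with the restricted divisor map — under the
[FrdI] Thm 5.2 hypotheses on `(Φ^⊛, 𝔹)` and the [FrdI] Prop 1.6 hypotheses on `†𝒟^⊚ → †𝒟^⊛`, BY NAME.
([IUTchI] Ex 5.1 (vi) p.130) [claim: Mochizuki2012, status: disputed] -/
theorem nonempty_rationalFunctionMonoidStr_fiberProductOverIdentify (h : ModelFrobenioid.Hypotheses Δ.Φ Δ.B)
    (hDc : IsGraphConnected Dcirc) (hDe : IsTotallyEpimorphic Dcirc)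
    (hFSM : ∀ {A A' : Dcirc} (f : A' ⟶ A), IsFSM f → IsFSM ((F.baseMor ⋙ F.identify.functor).map f)) :
    Nonempty (PreFrobenioid.RationalFunctionMonoidStr
      (PreFrobenioid.fiberProductFunctor (F.equiv.functor ⋙ ModelFrobenioid.toElem Δ.Φ Δ.B Δ.div)
        (F.baseMor ⋙ F.identify.functor))
      (F.isFrobenioid_fiberProductOverIdentify h.isMonoidOn h.isDivisorial h.isMonoidOn_rat h.isGroupLike_rat
        hDc hDe hFSM)
      ((F.baseMor ⋙ F.identify.functor).op ⋙ Δ.B) (Functor.whiskerLeft (F.baseMor ⋙ F.identify.functor).op Δ.div)) := by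
  obtain ⟨S⟩ := F.nonempty_rationalFunctionMonoidStr_equivToElem h
  exact PreFrobenioid.RationalFunctionMonoidStr.nonempty_fiberProduct _ _ S

/-- **[IUTchI] Ex 5.1 (vi)/(iv) for t1's literal `†ℱ^⊚ = †ℱ^⊛|_{†𝒟^⊚}`** (`GlobalFrobenioid.Fcirc`): along the
components-preserving equivalence `e` to the Prop 1.6 model (w4-d050 gen 0) and the induced Frobenioid structure,
the rational-function monoid of `†ℱ^⊚` IS `A_⊚ ↦ 𝔹(A_⊚ ↦ †𝒟^⊛)` with the restricted divisor map — objectwise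
`𝔹(†𝒟^⊚ ∋ A_⊚ ↦ †𝒟^⊛) ≅ 𝒪^×(A^birat)` compatibly with divisors, naturally along linear morphisms ([FrdI] Prop 2.2
(ii)) — under the [FrdI] Thm 5.2 / Prop 1.6 hypotheses BY NAME. ([IUTchI] Ex 5.1 (vi) p.130) [claim: Mochizuki2012, status: disputed] -/
theorem fcirc_exists_rationalFunctionMonoidStr (h : ModelFrobenioid.Hypotheses Δ.Φ Δ.B)
    (hDc : IsGraphConnected Dcirc) (hDe : IsTotallyEpimorphic Dcirc)
    (hFSM : ∀ {A A' : Dcirc} (f : A' ⟶ A), IsFSM f → IsFSM ((F.baseMor ⋙ F.identify.functor).map f)) :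
    ∃ e : F.Fcirc ≌ PreFrobenioid.FiberProduct
        (F.equiv.functor ⋙ ModelFrobenioid.toElem Δ.Φ Δ.B Δ.div) (F.baseMor ⋙ F.identify.functor),
      (∀ X, (e.functor.obj X).fst = X.fst ∧ (e.functor.obj X).snd = X.snd) ∧
      ∃ hF : PreFrobenioid.IsFrobenioid (e.functor ⋙ PreFrobenioid.fiberProductFunctor
          (F.equiv.functor ⋙ ModelFrobenioid.toElem Δ.Φ Δ.B Δ.div) (F.baseMor ⋙ F.identify.functor)),
        Nonempty (PreFrobenioid.RationalFunctionMonoidStr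
          (e.functor ⋙ PreFrobenioid.fiberProductFunctor (F.equiv.functor ⋙ ModelFrobenioid.toElem Δ.Φ Δ.B Δ.div)
            (F.baseMor ⋙ F.identify.functor)) hF
          ((F.baseMor ⋙ F.identify.functor).op ⋙ Δ.B)
          (Functor.whiskerLeft (F.baseMor ⋙ F.identify.functor).op Δ.div)) := by
  obtain ⟨e, he, hF⟩ := F.fcirc_isFrobenioid h.isMonoidOn h.isDivisorial h.isMonoidOn_rat h.isGroupLike_rat
    hDc hDe hFSM
  obtain ⟨S⟩ := F.nonempty_rationalFunctionMonoidStr_fiberProductOverIdentify h hDc hDe hFSM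
  exact ⟨e, he, hF, PreFrobenioid.RationalFunctionMonoidStr.nonempty_precomp_equivalence e _ hF S⟩

end General

/-! ### `†𝒟^⊚ = ℬ(π₁(†𝒟^⊚))⁰`: the [FrdI] Prop 1.6 inputs discharged -/

section OfBaseCat

variable {G H : ProfiniteGrp.{u}} {Δ : GlobalDivisorData G} {toBase0 : BaseCat H ⥤ BaseCat G}
  (𝓕 : GlobalFrobenioid Δ (BaseCat H) toBase0)

/-- **(vi)/(iv) for `†ℱ^⊚` with `†𝒟^⊚ = ℬ(π₁(†𝒟^⊚))⁰`**: as `fcirc_exists_rationalFunctionMonoidStr`, the three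
[FrdI] Prop 1.6 base-change inputs DISCHARGED for ANY functor `†𝒟^⊚ = ℬ(H)⁰ → †𝒟^⊛` (w4-d050 gen 2:
`isGraphConnected_baseCat`, `isTotallyEpimorphic_baseCat`, `isFSM_map_of_baseCat`); only the [FrdI] Thm 5.2 inputs
on `(Φ^⊛, 𝔹)` remain, packaged as `Hypotheses`. ([IUTchI] Ex 5.1 (vi) p.130) [claim: Mochizuki2012, status: disputed] -/
theorem fcirc_exists_rationalFunctionMonoidStr_of_baseCat (h : ModelFrobenioid.Hypotheses Δ.Φ Δ.B) :
    ∃ e : 𝓕.Fcirc ≌ PreFrobenioid.FiberProduct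
        (𝓕.equiv.functor ⋙ ModelFrobenioid.toElem Δ.Φ Δ.B Δ.div) (𝓕.baseMor ⋙ 𝓕.identify.functor),
      (∀ X, (e.functor.obj X).fst = X.fst ∧ (e.functor.obj X).snd = X.snd) ∧
      ∃ hF : PreFrobenioid.IsFrobenioid (e.functor ⋙ PreFrobenioid.fiberProductFunctor
          (𝓕.equiv.functor ⋙ ModelFrobenioid.toElem Δ.Φ Δ.B Δ.div) (𝓕.baseMor ⋙ 𝓕.identify.functor)),
        Nonempty (PreFrobenioid.RationalFunctionMonoidStr
          (e.functor ⋙ PreFrobenioid.fiberProductFunctor (𝓕.equiv.functor ⋙ ModelFrobenioid.toElem Δ.Φ Δ.B Δ.div)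
            (𝓕.baseMor ⋙ 𝓕.identify.functor)) hF
          ((𝓕.baseMor ⋙ 𝓕.identify.functor).op ⋙ Δ.B)
          (Functor.whiskerLeft (𝓕.baseMor ⋙ 𝓕.identify.functor).op Δ.div)) :=
  𝓕.fcirc_exists_rationalFunctionMonoidStr h (isGraphConnected_baseCat H) (isTotallyEpimorphic_baseCat H)
    (fun f hf => isFSM_map_of_baseCat (𝓕.baseMor ⋙ 𝓕.identify.functor) f hf)

end OfBaseCat

/-! ### Unconditional instances at the arithmetic models -/

section Arith

variable {F₀ : Type} [Field F₀] [NumberField F₀] {H : ProfiniteGrp.{0}}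
  {toBase0 : BaseCat H ⥤ BaseCat (absGalGrp F₀)}
  (𝓕 : GlobalFrobenioid (GlobalDivisorData.arith F₀) (BaseCat H) toBase0)

/-- **(vi)/(iv) for `†ℱ^⊚` — UNCONDITIONAL at the arithmetic model `π₁(†𝒟^⊛) = G_{F_mod}`, `†𝒟^⊚ = ℬ(H)⁰`.**
([IUTchI] Ex 5.1 (vi) p.130) [claim: Mochizuki2012, status: disputed] -/
theorem fcirc_exists_rationalFunctionMonoidStr_arith_of_baseCat :
    ∃ e : 𝓕.Fcirc ≌ PreFrobenioid.FiberProduct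
        (𝓕.equiv.functor ⋙ ModelFrobenioid.toElem _ _ (GlobalDivisorData.arith F₀).div)
        (𝓕.baseMor ⋙ 𝓕.identify.functor),
      (∀ X, (e.functor.obj X).fst = X.fst ∧ (e.functor.obj X).snd = X.snd) ∧
      ∃ hF : PreFrobenioid.IsFrobenioid (e.functor ⋙ PreFrobenioid.fiberProductFunctor
          (𝓕.equiv.functor ⋙ ModelFrobenioid.toElem _ _ (GlobalDivisorData.arith F₀).div)
          (𝓕.baseMor ⋙ 𝓕.identify.functor)),
        Nonempty (PreFrobenioid.RationalFunctionMonoidStr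
          (e.functor ⋙ PreFrobenioid.fiberProductFunctor
            (𝓕.equiv.functor ⋙ ModelFrobenioid.toElem _ _ (GlobalDivisorData.arith F₀).div)
            (𝓕.baseMor ⋙ 𝓕.identify.functor)) hF
          ((𝓕.baseMor ⋙ 𝓕.identify.functor).op ⋙ (GlobalDivisorData.arith F₀).B)
          (Functor.whiskerLeft (𝓕.baseMor ⋙ 𝓕.identify.functor).op (GlobalDivisorData.arith F₀).div)) :=
  𝓕.fcirc_exists_rationalFunctionMonoidStr_of_baseCat (GlobalDivisorData.arith_hypotheses F₀)

/-- … read on objects of t1's `†ℱ^⊚`: for `A = (A_⊛, A_⊚, −) ∈ Ob(†ℱ^⊚)` there is an isomorphism from the unit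
group `(F̄^{Stab(a)})^×` of the number field of the IMAGE in `†𝒟^⊛` (under `†𝒟^⊚ → Base(†ℱ^⊛) ⥲ †𝒟^⊛`) of the
`†𝒟^⊚`-component of `e(A)` — which IS `A_⊚` by the first clause — onto `𝒪^×(A^birat)` (computed in `†ℱ^⊚` with the
structure induced through `e`), carrying `f ↦ div f` to the divisor map of [FrdI] Prop 4.4 (iii): "the
multiplicative group of nonzero elements of the number field […] corresponding to `A`", now for `†ℱ^⊚`.
([IUTchI] Ex 5.1 (vi) p.130) [claim: Mochizuki2012, status: disputed] -/
theorem fcirc_exists_units_mulEquiv_biratUnits_arith_of_baseCat :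
    ∃ e : 𝓕.Fcirc ≌ PreFrobenioid.FiberProduct
        (𝓕.equiv.functor ⋙ ModelFrobenioid.toElem _ _ (GlobalDivisorData.arith F₀).div)
        (𝓕.baseMor ⋙ 𝓕.identify.functor),
      (∀ X, (e.functor.obj X).fst = X.fst ∧ (e.functor.obj X).snd = X.snd) ∧
      ∃ hF : PreFrobenioid.IsFrobenioid (e.functor ⋙ PreFrobenioid.fiberProductFunctor
          (𝓕.equiv.functor ⋙ ModelFrobenioid.toElem _ _ (GlobalDivisorData.arith F₀).div)
          (𝓕.baseMor ⋙ 𝓕.identify.functor)),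
        ∀ A : 𝓕.Fcirc, ∃ ι :
          (↥(fixFld F₀ ((BCat.connectedToBTemp (GalFbar F₀)).obj
            (𝓕.identify.functor.obj (𝓕.baseMor.obj (e.functor.obj A).snd)))))ˣ ≃*
            PreFrobenioid.BiratUnits (e.functor ⋙ PreFrobenioid.fiberProductFunctor
              (𝓕.equiv.functor ⋙ ModelFrobenioid.toElem _ _ (GlobalDivisorData.arith F₀).div)
              (𝓕.baseMor ⋙ 𝓕.identify.functor)) hF A,
          ∀ b, PreFrobenioid.BiratUnits.divHom hF A (ι b) =
            ((GlobalDivisorData.arith F₀).div.app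
              (op (𝓕.identify.functor.obj (𝓕.baseMor.obj (e.functor.obj A).snd)))).hom b := by
  obtain ⟨e, he, hF, ⟨S⟩⟩ := 𝓕.fcirc_exists_rationalFunctionMonoidStr_arith_of_baseCat
  exact ⟨e, he, hF, fun A => ⟨S.iso A, S.div_iso A⟩⟩

end Arith

section ArithAlong

variable {G H : ProfiniteGrp.{0}} {F₀ : Type} [Field F₀] [NumberField F₀] {ρ : G →ₜ* GalFbar F₀}
  {hρ : Function.Surjective ρ} {toBase0 : BaseCat H ⥤ BaseCat G}
  (𝓕 : GlobalFrobenioid (GlobalDivisorData.arithAlong F₀ ρ hρ) (BaseCat H) toBase0)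

/-- **(vi)/(iv) for `†ℱ^⊚` — UNCONDITIONAL over a general `†𝒟^⊛ = ℬ(π₁(†𝒟^⊛))⁰` acting through
`ρ : π₁(†𝒟^⊛) ↠ G_{F_mod}`, `†𝒟^⊚ = ℬ(π₁(†𝒟^⊚))⁰`.** ([IUTchI] Ex 5.1 (vi) p.130) [claim: Mochizuki2012, status: disputed] -/
theorem fcirc_exists_rationalFunctionMonoidStr_arithAlong_of_baseCat :
    ∃ e : 𝓕.Fcirc ≌ PreFrobenioid.FiberProduct
        (𝓕.equiv.functor ⋙ ModelFrobenioid.toElem _ _ (GlobalDivisorData.arithAlong F₀ ρ hρ).div)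
        (𝓕.baseMor ⋙ 𝓕.identify.functor),
      (∀ X, (e.functor.obj X).fst = X.fst ∧ (e.functor.obj X).snd = X.snd) ∧
      ∃ hF : PreFrobenioid.IsFrobenioid (e.functor ⋙ PreFrobenioid.fiberProductFunctor
          (𝓕.equiv.functor ⋙ ModelFrobenioid.toElem _ _ (GlobalDivisorData.arithAlong F₀ ρ hρ).div)
          (𝓕.baseMor ⋙ 𝓕.identify.functor)),
        Nonempty (PreFrobenioid.RationalFunctionMonoidStr
          (e.functor ⋙ PreFrobenioid.fiberProductFunctor
            (𝓕.equiv.functor ⋙ ModelFrobenioid.toElem _ _ (GlobalDivisorData.arithAlong F₀ ρ hρ).div)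
            (𝓕.baseMor ⋙ 𝓕.identify.functor)) hF
          ((𝓕.baseMor ⋙ 𝓕.identify.functor).op ⋙ (GlobalDivisorData.arithAlong F₀ ρ hρ).B)
          (Functor.whiskerLeft (𝓕.baseMor ⋙ 𝓕.identify.functor).op (GlobalDivisorData.arithAlong F₀ ρ hρ).div)) :=
  𝓕.fcirc_exists_rationalFunctionMonoidStr_of_baseCat (GlobalDivisorData.arithAlong_hypotheses F₀ ρ hρ)

end ArithAlong

/-! ### `†ℱ^⊛_mod := †ℱ^⊛|_{terminal objects}` (Ex 5.1 (iii)/(iv)) -/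

section Fmod

variable {G : ProfiniteGrp.{u}} {Δ : GlobalDivisorData G} {Dcirc : Type (u + 1)} [Category.{u} Dcirc]
  {toBase0 : Dcirc ⥤ BaseCat G} (F : GlobalFrobenioid Δ Dcirc toBase0)

/-- **(iv) for `†ℱ^⊛_mod`** ("`†ℱ^⊛_mod := †ℱ^⊛|_{terminal objects}` […] arithmetic line bundles on the stack
"`S_mod`"", p. 126; its birationalization `†ℱ^{⊛birat}_mod` is among those named in (iv) l. 15–17): along the
equivalence `e` of `†ℱ^⊛_mod` with the [FrdI] Prop 1.6 fibre product over the terminal objects of `†𝒟^⊛`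
(w4-d050 gen 0, `fmod_isFrobenioid`, identity on the `†ℱ^⊛`-component), the rational-function monoid of
`†ℱ^⊛_mod` IS `𝔹` restricted to the terminal objects, with the restricted divisor map, naturally — under the
[FrdI] Thm 5.2 hypotheses on `(Φ^⊛, 𝔹)` BY NAME (the three Prop 1.6 inputs being theorems for terminal objects).
([IUTchI] Ex 5.1 (iv) p.126) [claim: Mochizuki2012, status: disputed] -/
theorem fmod_exists_rationalFunctionMonoidStr (h : ModelFrobenioid.Hypotheses Δ.Φ Δ.B) :
    ∃ e : F.Fmod ≌ PreFrobenioid.FiberProduct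
        (F.equiv.functor ⋙ ModelFrobenioid.toElem Δ.Φ Δ.B Δ.div)
        (ObjectProperty.ι (fun X : BaseCat G => Nonempty (Limits.IsTerminal X))),
      (∀ A, (e.functor.obj A).fst = A.obj) ∧
      ∃ hF : PreFrobenioid.IsFrobenioid (e.functor ⋙ PreFrobenioid.fiberProductFunctor
          (F.equiv.functor ⋙ ModelFrobenioid.toElem Δ.Φ Δ.B Δ.div)
          (ObjectProperty.ι (fun X : BaseCat G => Nonempty (Limits.IsTerminal X)))),
        Nonempty (PreFrobenioid.RationalFunctionMonoidStr
          (e.functor ⋙ PreFrobenioid.fiberProductFunctor (F.equiv.functor ⋙ ModelFrobenioid.toElem Δ.Φ Δ.B Δ.div)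
            (ObjectProperty.ι (fun X : BaseCat G => Nonempty (Limits.IsTerminal X)))) hF
          ((ObjectProperty.ι (fun X : BaseCat G => Nonempty (Limits.IsTerminal X))).op ⋙ Δ.B)
          (Functor.whiskerLeft (ObjectProperty.ι (fun X : BaseCat G => Nonempty (Limits.IsTerminal X))).op
            Δ.div)) := by
  obtain ⟨e, he, hF⟩ := F.fmod_isFrobenioid h.isMonoidOn h.isDivisorial h.isMonoidOn_rat h.isGroupLike_rat
  have hF' : PreFrobenioid.IsFrobenioid (PreFrobenioid.fiberProductFunctor
      (F.equiv.functor ⋙ ModelFrobenioid.toElem Δ.Φ Δ.B Δ.div)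
      (ObjectProperty.ι (fun X : BaseCat G => Nonempty (Limits.IsTerminal X)))) :=
    PreFrobenioid.isFrobenioid_fiberProduct
      (F.isFrobenioid_equivToElem h.isMonoidOn h.isDivisorial h.isMonoidOn_rat h.isGroupLike_rat)
      (isGraphConnected_terminalPart G) (isTotallyEpimorphic_terminalPart G) (fun f _ => isFSM_terminalPart_ι_map G f)
  obtain ⟨S₀⟩ := F.nonempty_rationalFunctionMonoidStr_equivToElem h
  obtain ⟨S₁⟩ := PreFrobenioid.RationalFunctionMonoidStr.nonempty_fiberProduct _ hF' S₀
  exact ⟨e, he, hF, PreFrobenioid.RationalFunctionMonoidStr.nonempty_precomp_equivalence e _ hF S₁⟩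

/-- **`𝒪^×(A^birat) ≅ F_mod^×` for `A ∈ Ob(†ℱ^⊛_mod)`, computed IN `†ℱ^⊛_mod`** — UNCONDITIONAL at the arithmetic
model (`F₀` in the role of `F_mod`): the base of `A` in the induced structure is a terminal object "`C_{F_mod}`",
whose number field is the bottom field (`arith_field_terminal`); "the Frobenioid of arithmetic line bundles on
the stack "`S_mod`"" thus has `F_mod^×` as its rational functions, compatibly with nothing further claimed.
([IUTchI] Ex 5.1 (iv) p.126) [claim: Mochizuki2012, status: disputed] -/
theorem fmod_exists_units_mulEquiv_biratUnits_arith {F₀ : Type} [Field F₀] [NumberField F₀] {Dcirc : Type 1}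
    [Category.{0} Dcirc] {toBase0 : Dcirc ⥤ BaseCat (absGalGrp F₀)}
    (𝓕 : GlobalFrobenioid (GlobalDivisorData.arith F₀) Dcirc toBase0) :
    ∃ e : 𝓕.Fmod ≌ PreFrobenioid.FiberProduct
        (𝓕.equiv.functor ⋙ ModelFrobenioid.toElem _ _ (GlobalDivisorData.arith F₀).div)
        (ObjectProperty.ι (fun X : BaseCat (absGalGrp F₀) => Nonempty (Limits.IsTerminal X))),
      (∀ A, (e.functor.obj A).fst = A.obj) ∧
      ∃ hF : PreFrobenioid.IsFrobenioid (e.functor ⋙ PreFrobenioid.fiberProductFunctor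
          (𝓕.equiv.functor ⋙ ModelFrobenioid.toElem _ _ (GlobalDivisorData.arith F₀).div)
          (ObjectProperty.ι (fun X : BaseCat (absGalGrp F₀) => Nonempty (Limits.IsTerminal X)))),
        ∀ A : 𝓕.Fmod, Nonempty (F₀ˣ ≃*
          PreFrobenioid.BiratUnits (e.functor ⋙ PreFrobenioid.fiberProductFunctor
            (𝓕.equiv.functor ⋙ ModelFrobenioid.toElem _ _ (GlobalDivisorData.arith F₀).div)
            (ObjectProperty.ι (fun X : BaseCat (absGalGrp F₀) => Nonempty (Limits.IsTerminal X)))) hF A) := by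
  obtain ⟨e, he, hF, ⟨S⟩⟩ := 𝓕.fmod_exists_rationalFunctionMonoidStr (GlobalDivisorData.arith_hypotheses F₀)
  refine ⟨e, he, hF, fun A => ?_⟩
  have hbot : ((galoisSubextOfFinite F₀).obj (e.functor.obj A).snd.obj).L = ⊥ :=
    arith_field_terminal F₀ (e.functor.obj A).snd.property.some
  have j : F₀ ≃ₐ[F₀] ↥((galoisSubextOfFinite F₀).obj (e.functor.obj A).snd.obj).L :=
    (IntermediateField.botEquiv F₀ (Fbar F₀)).symm.trans (IntermediateField.equivOfEq hbot.symm)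
  exact ⟨(Units.mapEquiv j.toMulEquiv).trans (S.iso A)⟩

end Fmod

end GlobalFrobenioid

end Literature.IUT.HodgeTheaters

end
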